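import Summits.Ventures.HodgeRepro2.T6B1Construct

/-!
# T6B1Incoherent — the incoherent completion `𝕍` of `V(τ)` (Tier-6 sub-goal B1, proof lane)

Steps 4–5 of route/T6-B1-t6-p4.md §3 (= TIER4 B1, Lemma B1.4.2 and Lemma B1.4.1's «τ-nearby» clause, in the
kernel's order): given `α ∈ K^×` with `(α, θ)_𝔭 = −1` exactly at `𝔭 ∈ {v₀, τ}` (T6B1Construct), the adelic space
`𝕍 := (A_E³, diag(1, 1, a))` with the idèle `a` equal to `α` at every spot `≠ τ` and to `1` at `τ` is

* totally positive definite (`I₃` at `τ`, `diag(1, 1, α_w)` with `α_w > 0` at the other real places);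
* INCOHERENT in the sense of Liu's Def. C.3: if `a = f · N(x)` with `f ∈ K^×`, `x ∈ A_E^×`, then at every spot
  `𝔭 ≠ τ` the symbols `(f, θ)_𝔭` and `(α, θ)_𝔭` agree (a norm is a local norm; local norms form a group; 63:10),
  at `τ` the symbol `(f, θ)_τ` is `1`, so `∏_𝔭 (f, θ)_𝔭 = (−1)^{|{v₀}|} = −1`, contradicting the displayed Hilbert
  Reciprocity Law `Hyp.OMeara1963_71_18`;
* and `V(τ) = W α` is `τ`-nearby to it (Def. C.4): away from `τ` the two Gram matrices coincide (isometry `P = I₃`),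
  and `W α` has signature `(2, 1)` at `τ`.
-/

namespace Summit.Ventures.HodgeRepro2.T6
namespace B1Incoherent

open NumberField IsDedekindDomain Matrix B1Carriers B1Local B1Construct
open scoped ComplexOrder

noncomputable section

variable (K : Type*) [Field K] [NumberField K]

/-! ## The idèle `a` and the adelic space `𝕍` -/

open Classical in
/-- The adèle `a(α, τ) ∈ A_F`: `α` at every spot other than `τ`, `1` at `τ`. -/
def adeleA (τ : InfinitePlace K) (α : K) : AK K :=
  ((fun w : InfinitePlace K => if w = τ then (1 : w.Completion) else algebraMap K w.Completion α),
    algebraMap K (FiniteAdeleRing (𝓞 K) K) α)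

open Classical in
/-- The archimedean components of `a(α, τ)`. -/
theorem infComp_adeleA (τ : InfinitePlace K) (α : K) (w : InfinitePlace K) :
    infComp K w (adeleA K τ α) = if w = τ then 1 else algebraMap K w.Completion α := rfl

/-- The discrete components of `a(α, τ)`. -/
theorem finComp_adeleA (τ : InfinitePlace K) (α : K) (v : HeightOneSpectrum (𝓞 K)) :
    finComp K v (adeleA K τ α) = algebraMap K (v.adicCompletion K) α := rfl

/-- `a(α, τ)` is an idèle when `α ≠ 0`. -/
theorem isUnit_adeleA (τ : InfinitePlace K) {α : K} (hα : α ≠ 0) : IsUnit (adeleA K τ α) := by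
  classical
  have h1 : IsUnit ((fun w : InfinitePlace K => if w = τ then (1 : w.Completion) else algebraMap K w.Completion α) :
      (w : InfinitePlace K) → w.Completion) := by
    rw [Pi.isUnit_iff]
    intro w
    split_ifs
    · exact isUnit_one
    · exact (isUnit_iff_ne_zero.2 hα).map _
  have h2 : IsUnit (algebraMap K (FiniteAdeleRing (𝓞 K) K) α) := (isUnit_iff_ne_zero.2 hα).map _
  exact (Prod.isUnit_iff.2 ⟨h1, h2⟩ : IsUnit (((fun w : InfinitePlace K =>
    if w = τ then (1 : w.Completion) else algebraMap K w.Completion α), algebraMap K (FiniteAdeleRing (𝓞 K) K) α) :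
    ((w : InfinitePlace K) → w.Completion) × FiniteAdeleRing (𝓞 K) K))

/-- The diagonal entries `(1, 1, a)` of `𝕍`, in `A_E`. -/
def vDiag (θ : K) (τ : InfinitePlace K) (α : K) : Fin 3 → AE K θ :=
  ![1, 1, algebraMap (AK K) (AE K θ) (adeleA K τ α)]

/-- The image of an element of `A_F` in `A_E` is self-adjoint. -/
theorem isSelfAdjoint_algebraMap_adelic (θ : K) (a : AK K) : IsSelfAdjoint (algebraMap (AK K) (AE K θ) a) := by
  rw [isSelfAdjoint_iff]
  ext <;> simp [QuadraticAlgebra.algebraMap_eq]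

/-- The adelic hermitian space `𝕍 = (A_E³, diag(1, 1, a(α, τ)))`. -/
def V (θ : K) (τ : InfinitePlace K) {α : K} (hα : α ≠ 0) : AdelicHermitianSpace K θ 3 where
  gram := Matrix.diagonal (vDiag K θ τ α)
  isHermitian := by
    rw [Matrix.isHermitian_diagonal_iff]
    intro i
    fin_cases i
    · rw [isSelfAdjoint_iff]; exact star_one _
    · rw [isSelfAdjoint_iff]; exact star_one _
    · exact isSelfAdjoint_algebraMap_adelic K θ _
  isUnit_det := by
    rw [Matrix.det_diagonal, Fin.prod_univ_three]
    simp only [vDiag, Matrix.cons_val_zero, Matrix.cons_val_one, Matrix.cons_val_two, Matrix.head_cons,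
      Matrix.tail_cons, one_mul]
    exact (isUnit_adeleA K τ hα).map (algebraMap (AK K) (AE K θ))

/-- The Gram matrix of `𝕍`. -/
theorem V_gram (θ : K) (τ : InfinitePlace K) {α : K} (hα : α ≠ 0) :
    (V K θ τ hα).gram = Matrix.diagonal (vDiag K θ τ α) := rfl

/-- The determinant of `𝕍`'s Gram matrix is `a(α, τ)`. -/
theorem V_det_re (θ : K) (τ : InfinitePlace K) {α : K} (hα : α ≠ 0) :
    (V K θ τ hα).gram.det.re = adeleA K τ α := by
  rw [V_gram, Matrix.det_diagonal, Fin.prod_univ_three]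
  simp only [vDiag, Matrix.cons_val_zero, Matrix.cons_val_one, Matrix.cons_val_two, Matrix.head_cons,
    Matrix.tail_cons, one_mul]
  rfl

/-! ## Total positive definiteness -/

/-- `adelicToComplex` on the image of `a ∈ A_F` is the real number `a_w`. -/
theorem adelicToComplex_algebraMap (θ : K) {w : InfinitePlace K} (hw : w.IsReal) (a : AK K) :
    adelicToComplex K θ hw (algebraMap (AK K) (AE K θ) a) = (realComp K hw a : ℂ) := by
  simp only [adelicToComplex, RingHom.comp_apply, extMap_apply, QuadraticAlgebra.algebraMap_eq,
    realExtToComplex_apply, map_zero, Complex.ofReal_zero, zero_mul, add_zero]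

open Classical in
/-- `realComp` of `a(α, τ)` at a real place `w`. -/
theorem realComp_adeleA {w : InfinitePlace K} (hw : w.IsReal) (τ : InfinitePlace K) (α : K) :
    realComp K hw (adeleA K τ α) = if w = τ then 1 else realOf K hw α := by
  unfold realComp
  rw [RingHom.comp_apply, infComp_adeleA]
  split_ifs
  · simp
  · rfl

open Classical in
/-- `𝕍 ⊗_{A_F,w} ℝ` is `diag(1, 1, 1)` at `τ` and `diag(1, 1, α_w)` at the other real places. -/
theorem V_gramAt (θ : K) (τ : InfinitePlace K) {α : K} (hα : α ≠ 0) {w : InfinitePlace K} (hw : w.IsReal) :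
    (V K θ τ hα).gram.map (adelicToComplex K θ hw) =
      Matrix.diagonal ![1, 1, if w = τ then (1 : ℂ) else (realOf K hw α : ℂ)] := by
  rw [V_gram, Matrix.diagonal_map (map_zero _)]
  congr 1
  ext i
  fin_cases i
  · simp [vDiag]
  · simp [vDiag]
  · simp only [vDiag, Fin.reduceFinMk, Matrix.cons_val_two, Matrix.tail_cons, Matrix.head_cons]
    rw [adelicToComplex_algebraMap, realComp_adeleA]
    split_ifs <;> simp

/-- `𝕍` is totally positive definite when `α_w > 0` at every real place `w ≠ τ`. -/
theorem isTotallyPositiveDefinite_V (θ : K) (τ : InfinitePlace K) {α : K} (hα : α ≠ 0)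
    (hpos : ∀ (w : InfinitePlace K) (hw : w.IsReal), w ≠ τ → 0 < realOf K hw α) :
    IsTotallyPositiveDefinite K (V K θ τ hα) := by
  classical
  intro w hw
  rw [V_gramAt]
  rw [Matrix.posDef_diagonal_iff]
  intro i
  fin_cases i
  · simp
  · simp
  · simp only [Fin.reduceFinMk, Matrix.cons_val_two, Matrix.tail_cons, Matrix.head_cons]
    split_ifs with h
    · exact zero_lt_one
    · simpa using hpos w hw h

/-! ## Incoherence (Liu Def. C.3) from the Hilbert Reciprocity Law -/

/-- The norm of a unit of `E_v` (or of any `Ext L θ`, `L` a field) is non-zero. -/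
theorem norm_ne_zero_of_isUnit {L : Type*} [Field L] {θ : L} {z : Ext L θ} (hz : IsUnit z) :
    QuadraticAlgebra.norm z ≠ 0 :=
  (QuadraticAlgebra.isUnit_iff_norm_isUnit.1 hz).ne_zero

/-- The symbol `(1, θ)` is `1`. -/
theorem hilbertSymbol_one_left {L : Type*} [Field L] (θ : L) : hilbertSymbol L 1 θ = 1 :=
  (hilbertSymbol_eq_one_iff 1 θ).2 ⟨1, 0, by ring⟩

/-- At a discrete spot, if `a(α, τ) = f · N(x)` then `(f, θ)_v = (α, θ)_v`. -/
theorem hilbertFin_eq_of_eq (θ : K) (τ : InfinitePlace K) {α : K} (hα : α ≠ 0) (f : K) (x : (AE K θ)ˣ)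
    (hfx : adeleA K τ α = algebraMap K (AK K) f * QuadraticAlgebra.norm (x : AE K θ))
    (v : HeightOneSpectrum (𝓞 K)) : hilbertFin K v f θ = hilbertFin K v α θ := by
  have h := congrArg (finComp K v) hfx
  rw [finComp_adeleA, map_mul, finComp_algebraMap, ← norm_extMap (finComp K v) (finComp_algebraMap K v θ)] at h
  unfold hilbertFin
  exact hilbertSymbol_eq_of_mul_isNormFrom (two_ne_zero_of_algebra K _)
    ((map_ne_zero _).2 hα) h (isNormFrom_norm _ _)
    (norm_ne_zero_of_isUnit (x.isUnit.map (compFin K θ v)))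

open Classical in
/-- At an archimedean spot `w ≠ τ`, if `a(α, τ) = f · N(x)` then `(f, θ)_w = (α, θ)_w`. -/
theorem hilbertInf_eq_of_eq (θ : K) (τ : InfinitePlace K) {α : K} (hα : α ≠ 0) (f : K) (x : (AE K θ)ˣ)
    (hfx : adeleA K τ α = algebraMap K (AK K) f * QuadraticAlgebra.norm (x : AE K θ))
    (w : InfinitePlace K) (hw : w ≠ τ) : hilbertInf K w f θ = hilbertInf K w α θ := by
  have h := congrArg (infComp K w) hfx
  rw [infComp_adeleA, if_neg hw, map_mul, infComp_algebraMap,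
    ← norm_extMap (infComp K w) (infComp_algebraMap K w θ)] at h
  unfold hilbertInf
  exact hilbertSymbol_eq_of_mul_isNormFrom (two_ne_zero_of_algebra K _)
    ((map_ne_zero _).2 hα) h (isNormFrom_norm _ _)
    (norm_ne_zero_of_isUnit (x.isUnit.map (compInf K θ w)))

open Classical in
/-- At the spot `τ`, if `a(α, τ) = f · N(x)` then `(f, θ)_τ = 1`. -/
theorem hilbertInf_eq_one_at_τ (θ : K) (τ : InfinitePlace K) (α : K) (f : K) (x : (AE K θ)ˣ)
    (hfx : adeleA K τ α = algebraMap K (AK K) f * QuadraticAlgebra.norm (x : AE K θ)) :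
    hilbertInf K τ f θ = 1 := by
  have h := congrArg (infComp K τ) hfx
  rw [infComp_adeleA, if_pos rfl, map_mul, infComp_algebraMap,
    ← norm_extMap (infComp K τ) (infComp_algebraMap K τ θ)] at h
  unfold hilbertInf
  rw [hilbertSymbol_eq_of_mul_isNormFrom (two_ne_zero_of_algebra K _) one_ne_zero h (isNormFrom_norm _ _)
    (norm_ne_zero_of_isUnit (x.isUnit.map (compInf K θ τ)))]
  exact hilbertSymbol_one_left _

open Classical in
/-- Lemma B1.4.2 (TIER4 B1): with `(α, θ)_𝔭 = −1` exactly at `𝔭 ∈ {v₀, τ}`, the adelic space `𝕍` is incoherent —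
a relation `a(α, τ) = f · N(x)` would force `∏_𝔭 (f, θ)_𝔭 = −1`, against the Hilbert Reciprocity Law. -/
theorem isIncoherentSpace_V (h : Hyp.OMeara1963_71_18 K) {θ : K} (hθ : θ ≠ 0) (τ : InfinitePlace K)
    {α : K} (hα : α ≠ 0) (v₀ : HeightOneSpectrum (𝓞 K))
    (hfin : ∀ v, hilbertFin K v α θ = if v = v₀ then -1 else 1)
    (hinf : ∀ w, hilbertInf K w α θ = if w = τ then -1 else 1) :
    IsIncoherentSpace K (V K θ τ hα) := by
  rintro ⟨f, x, hfx⟩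
  rw [V_det_re] at hfx
  have hf0 : (f : K) ≠ 0 := f.ne_zero
  have hF : ∀ v, hilbertFin K v f θ = if v = v₀ then -1 else 1 := fun v => by
    rw [hilbertFin_eq_of_eq K θ τ hα f x hfx v, hfin v]
  have hI : ∀ w, hilbertInf K w f θ = 1 := fun w => by
    by_cases hw : w = τ
    · subst hw; exact hilbertInf_eq_one_at_τ K θ w α f x hfx
    · rw [hilbertInf_eq_of_eq K θ τ hα f x hfx w hw, hinf w, if_neg hw]
  obtain ⟨-, hrec⟩ := h f θ hf0 hθ
  have hprod : (∏ᶠ v, hilbertFin K v f θ) = -1 := by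
    rw [finprod_eq_single (fun v => hilbertFin K v f θ) v₀ (fun v hv => by rw [hF v, if_neg hv])]
    rw [hF v₀, if_pos rfl]
  have hprod2 : (∏ w, hilbertInf K w f θ) = 1 := Finset.prod_eq_one (fun w _ => hI w)
  rw [hprod, hprod2] at hrec
  exact absurd hrec (by decide)

/-! ## `V(τ) = W α` is `τ`-nearby to `𝕍` (Liu Def. C.4) -/

open Classical in
/-- Away from `τ` the Gram matrices of `𝕍` and of `W α` coincide in `A_E^τ`. -/
theorem V_map_τ_eq_W_map_τ (θ : K) (τ : InfinitePlace K) {α : K} (hα : α ≠ 0) :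
    (V K θ τ hα).gram.map (adelicToτ K θ τ) = (W K θ hα).gram.map (globalToτ K θ τ) := by
  rw [V_gram, W_gram, Matrix.diagonal_map (map_zero _), Matrix.diagonal_map (map_zero _)]
  congr 1
  funext i
  fin_cases i
  · simp [vDiag, wDiag]
  · simp [vDiag, wDiag]
  · simp only [vDiag, wDiag, Fin.reduceFinMk, Matrix.cons_val_two, Matrix.tail_cons, Matrix.head_cons]
    refine QuadraticAlgebra.ext ?_ ?_
    · show restrictτ K τ (adeleA K τ α) = restrictτ K τ (algebraMap K (AK K) α)
      refine Prod.ext ?_ rfl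
      funext w
      exact if_neg w.2
    · rfl

/-- `W α` is `τ`-nearby to `𝕍` when `(α, θ)_τ = −1` (and `θ_τ < 0`). -/
theorem isNearbyAt_V_W (θ : K) {τ : InfinitePlace K} (hτ : τ.IsReal) (hθτ : realOf K hτ θ < 0) {α : K}
    (hα : α ≠ 0) (hsym : hilbertInf K τ α θ = -1) :
    IsNearbyAt K hτ (V K θ τ hα) (W K θ hα) := by
  refine ⟨⟨1, by simp, ?_⟩, hasSig_W_of_symbol_neg_one K θ hα hτ hθτ hsym⟩
  rw [Matrix.conjTranspose_one, Matrix.one_mul, Matrix.mul_one]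
  exact V_map_τ_eq_W_map_τ K θ τ hα

end

end B1Incoherent
end Summit.Ventures.HodgeRepro2.T6
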